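import Literature.NumberTheory.Automorphic.WhittakerTowerExpansion
import Literature.NumberTheory.Automorphic.CuspFormsGenericGLn
import HarnessLib

/-!
# The Fourier–Whittaker expansion of cusp forms on `GL_n(𝔸_K)` from the absolute convergence of the
Whittaker series: reduction of `Shalika1974_fourierExpansion_cuspForm`
(Cogdell (2004), §1.1, Thm. 1.1; Shalika (1974); Piatetski-Shapiro (1979))

Topic `NumberTheory/Automorphic`; namespace `Literature.NumberTheory.Automorphic`. The named fact
`Shalika1974_fourierExpansion_cuspForm` (`GlobalWhittakerCoefficient`; Cogdell's Thm. 1.1 for honest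
Borel–Jacquet cusp forms, every Haar measure `ν` of `N_n(𝔸_K)`, every fundamental domain `𝓕` of
`N_n(K)`, every global character `ψ`) asserts two things at every point `g`: the **absolute
convergence** of the Whittaker series `δ ↦ W^ψ_{ν,𝓕}(diag(δ⁻¹, 1) g)` over `GL_{n-1}(K) ⧸ N_{n-1}(K)`,
and the **expansion identity** (its sum is `φ(g)`). This file PROVES that the second follows from the
first, for all `n`: precisely, the named fact follows from the absolute convergence of the
Tate-normalised Whittaker series `γ ↦ Φ_0(diag(γ_𝔸, 1) x)` (`Φ_0 = whittakerDepth 0 φ`, right cosets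
`N_{n-1}(K) γ`) of every cusp form at every point (`Shalika1974_fourierExpansion_cuspForm_of_summable`),
by `hasSum_whittakerDepth_zero_of_summable` (`WhittakerTowerExpansion`: Cogdell's induction over the
mirabolic tower) and the normalisations of `CuspFormsGenericGLn` (`W^ψ_{ν,𝓕} = Φ_0(d_η ·)` with
`d_η = diag(η^{n-1}, …, η, 1)` rational):

* `glDiagonal_conj_mem_upperUnitriangular_iff` — a diagonal matrix normalises `N_m(K)`;
* `ratGL_dilationDiagonal_eq_glCorner` — `d_η = diag(t_η, 1)` with `t_η = diag(η^{n-1}, …, η) ∈ GL_{n-1}(K)`;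
* `bijective_rightCoset_conj_out_inv` — for `t` normalising `N ≤ G`, `δ ↦ N (t δ.out⁻¹ t⁻¹)` is a
  bijection from the left-coset space `G ⧸ N` onto the right-coset space `N \ G` (the re-indexing
  between the fact's `δ.out⁻¹`, `δ ∈ GL_{n-1}(K) ⧸ N_{n-1}(K)`, twisted by `t_η`, and the right cosets
  of `WhittakerTowerExpansion`);
* `hasSum_whittakerCoeff_of_summable` — for a cusp form `φ` whose Tate-normalised Whittaker series
  converges absolutely at every point: for every Haar `ν`, fundamental domain `𝓕`, global `ψ` and
  `g`, the family `δ ↦ W^ψ_{ν,𝓕}(diag(δ.out⁻¹, 1) g)` is absolutely summable with sum `φ(g)`;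
* `Shalika1974_fourierExpansion_cuspForm_of_summable` (**main**) — hence the named fact, for the given
  `n` and `K`, follows from the absolute convergence statement for the cusp forms on `GL_n(𝔸_K)`
  (`n = 0`: `Shalika1974_fourierExpansion_cuspForm_of_le_one`);
* `summable_whittakerDepth_zero_of_fourierExpansion`, `Shalika1974_fourierExpansion_cuspForm_iff_summable`
  — conversely the named fact contains that absolute convergence (Haar measure, Tate's box and
  character, `Φ_0 = W`), so **the fact is equivalent to the absolute convergence of the
  Tate-normalised Whittaker series of cusp forms**: the expansion identity is a theorem, the
  convergence is the remaining content.

What is NOT here: the absolute convergence itself (the analytic heart of Thm. 1.1: uniform moderate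
growth of cusp forms and their derivatives — Moeglin–Waldspurger I.2.17 on Harish-Chandra's
convolution identity, `AutomorphicRepsGL.exists_convolution_eq_self` in the tree — and a majorant of
`Φ_0(diag(γ_𝔸, 1) x)` summable over `N_{n-1}(K) \ GL_{n-1}(K)`); for `n ≤ 2` it is proved in the tree
(`CuspFormFourierExpansionGL2`).

## References

* J. W. Cogdell, in J. Bernstein, S. Gelbart (eds.), *An Introduction to the Langlands Program*
  (2004), §1.1, Thm. 1.1 (PDF pp. 176–177 of the held copy) [CogdellAnalyticTheory2004].
* J. A. Shalika, *The multiplicity one theorem for GL_n*, Ann. of Math. 100 (1974), §5 [Shalika1974].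
-/

noncomputable section

open MeasureTheory Measure NumberField IsDedekindDomain Set Function Filter Matrix
open Literature.LinearAlgebra.Matrix
open scoped MatrixGroups ComplexConjugate ENNReal Topology

namespace Literature.NumberTheory.Automorphic

/-! ### Re-indexing left cosets by right cosets through a normalising element -/

section Reindex

variable {G : Type*} [Group G] (N : Subgroup G)

/-- **Twisted inversion of cosets**: if `t` normalises the subgroup `N`, then
`δ ↦ N (t δ.out⁻¹ t⁻¹)` is a bijection from the left-coset space `G ⧸ N` onto the right-coset space
`N \ G` (inversion exchanges left and right cosets, conjugation by `t` permutes the right cosets).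
[folklore] -/
theorem bijective_rightCoset_conj_out_inv {t : G} (ht : ∀ u : G, u ∈ N ↔ t * u * t⁻¹ ∈ N) :
    Function.Bijective (fun δ : G ⧸ N => Quotient.mk (QuotientGroup.rightRel N) (t * δ.out⁻¹ * t⁻¹)) := by
  constructor
  · intro δ₁ δ₂ h
    have h1 : t * δ₂.out⁻¹ * t⁻¹ * (t * δ₁.out⁻¹ * t⁻¹)⁻¹ ∈ N := (rightRel_mk_eq_mk_iff N _ _).1 h
    have e : t * δ₂.out⁻¹ * t⁻¹ * (t * δ₁.out⁻¹ * t⁻¹)⁻¹ = t * (δ₂.out⁻¹ * δ₁.out) * t⁻¹ := by group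
    rw [e, ← ht] at h1
    have h2 : δ₁.out⁻¹ * δ₂.out ∈ N := by
      have := N.inv_mem h1
      rwa [_root_.mul_inv_rev, inv_inv] at this
    rw [← Quotient.out_eq' δ₁, ← Quotient.out_eq' δ₂]
    exact QuotientGroup.eq.2 h2
  · intro Q
    induction Q using Quotient.inductionOn with
    | h x =>
      refine ⟨QuotientGroup.mk (t⁻¹ * x⁻¹ * t), ?_⟩
      obtain ⟨h, hh⟩ := QuotientGroup.mk_out_eq_mul N (t⁻¹ * x⁻¹ * t)
      change Quotient.mk _ (t * (QuotientGroup.mk (s := N) (t⁻¹ * x⁻¹ * t) : G ⧸ N).out⁻¹ * t⁻¹) =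
        Quotient.mk _ x
      rw [hh]
      refine (rightRel_mk_eq_mk_iff N _ _).2 ?_
      have e : x * (t * (t⁻¹ * x⁻¹ * t * (h : G))⁻¹ * t⁻¹)⁻¹ = t * (h : G) * t⁻¹ := by group
      rw [e]
      exact (ht _).1 h.2

end Reindex

/-! ### The dilation matrix and the unitriangular group -/

section Torus

variable {K : Type} [Field K]

/-- **A diagonal matrix normalises `N_m(K)`**: `u` is upper unitriangular iff `d u d⁻¹` is.
[folklore] -/
theorem glDiagonal_conj_mem_upperUnitriangular_iff {m : ℕ} (d : Fin m → Kˣ) (u : GL (Fin m) K) :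
    u ∈ upperUnitriangular (Fin m) K ↔
      glDiagonal m K d * u * (glDiagonal m K d)⁻¹ ∈ upperUnitriangular (Fin m) K := by
  have hentry : ∀ i j : Fin m,
      ((glDiagonal m K d * u * (glDiagonal m K d)⁻¹ : GL (Fin m) K) : Matrix (Fin m) (Fin m) K) i j =
        (d i : K) * (u : Matrix (Fin m) (Fin m) K) i j * ((d j)⁻¹ : Kˣ) := by
    intro i j
    rw [Matrix.GeneralLinearGroup.coe_mul, Matrix.GeneralLinearGroup.coe_mul, ← map_inv, coe_glDiagonal,
      coe_glDiagonal, mul_diagonal, diagonal_mul]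
    rfl
  rw [mem_upperUnitriangular_iff, mem_upperUnitriangular_iff]
  constructor
  · rintro ⟨ht, hd⟩
    refine ⟨fun i j hij => ?_, fun i => ?_⟩
    · rw [hentry, ht hij, mul_zero, zero_mul]
    · rw [hentry, hd i, mul_one, ← Units.val_mul, mul_inv_cancel, Units.val_one]
  · rintro ⟨ht, hd⟩
    refine ⟨fun i j hij => ?_, fun i => ?_⟩
    · have h := ht hij
      rw [hentry, mul_eq_zero, mul_eq_zero] at h
      rcases h with (h | h) | h
      · exact absurd h (d i).ne_zero
      · exact h
      · exact absurd h ((d j)⁻¹).ne_zero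
    · have h := hd i
      rw [hentry, mul_comm ((d i : K)), mul_assoc, ← Units.val_mul, mul_inv_cancel, Units.val_one,
        mul_one] at h
      exact h

variable {n : ℕ}

/-- **`d_η = diag(t_η, 1)`**: the dilation matrix `diag(η^{n-1}, …, η, 1) ∈ GL_n(K)` is the corner of
`t_η = diag(η^{n-1}, …, η) ∈ GL_{n-1}(K)` (for `1 ≤ n`). [folklore] -/
theorem dilationDiagonal_eq_glCorner (hn : 1 ≤ n) (η : Kˣ) :
    glDiagonal n K (fun i : Fin n => η ^ (n - 1 - (i : ℕ))) =
      glCorner K (Nat.sub_le n 1) (glDiagonal (n - 1) K fun i : Fin (n - 1) => η ^ (n - 1 - (i : ℕ))) := by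
  refine Units.ext (Matrix.ext fun i j => ?_)
  rw [coe_glDiagonal, diagonal_apply, glCorner_apply_val]
  by_cases hi : (i : ℕ) < n - 1 <;> by_cases hj : (j : ℕ) < n - 1
  · rw [dif_pos hi, dif_pos hj, coe_glDiagonal, diagonal_apply]
    by_cases hij : i = j
    · subst hij
      rw [if_pos rfl, if_pos rfl]
    · rw [if_neg hij, if_neg]
      intro h
      exact hij (Fin.ext (by simpa using congrArg Fin.val h))
  · rw [dif_pos hi, dif_neg hj, if_neg]
    intro h; subst h; exact hj hi
  · rw [dif_neg hi, if_pos hj, if_neg]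
    intro h; subst h; exact hi hj
  · rw [dif_neg hi, if_neg hj]
    by_cases hij : i = j
    · subst hij
      rw [if_pos rfl, if_pos rfl]
      have h0 : n - 1 - (i : ℕ) = 0 := by omega
      rw [h0, pow_zero, Units.val_one]
    · rw [if_neg hij, if_neg hij]

variable [NumberField K] in
/-- The adelic dilation matrix is the adelic corner of `t_η`. [folklore] -/
theorem ratGL_dilationDiagonal_eq_glCorner (hn : 1 ≤ n) (η : Kˣ) :
    ratGL K (glDiagonal n K (fun i : Fin n => η ^ (n - 1 - (i : ℕ)))) =
      glCorner (AdeleRing (𝓞 K) K) (Nat.sub_le n 1)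
        (ratGL K (glDiagonal (n - 1) K fun i : Fin (n - 1) => η ^ (n - 1 - (i : ℕ)))) := by
  rw [dilationDiagonal_eq_glCorner hn, ratGL_glCorner]

end Torus

/-! ### The expansion from the absolute convergence -/

section Expansion

variable {n : ℕ} {K : Type} [Field K] [NumberField K]

-- `AutomorphyDatum.gl` lives over the coefficient algebra `mixedSpace K`, whose `Fintype` instances
-- need classical decidability (as in `GlobalWhittakerCoefficient`, H5).
open scoped Classical in
/-- **The Fourier–Whittaker expansion of a cusp form from the absolute convergence of its Whittaker
series** (Cogdell (2004), Thm. 1.1, the identity): let `φ` be a cusp form on `GL_n(𝔸_K)` (`1 ≤ n`)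
whose Tate-normalised Whittaker series `γ ↦ Φ_0(diag(γ_𝔸, 1) x)` over `N_{n-1}(K) \ GL_{n-1}(K)` is
absolutely summable at every `x` (for a Borel structure of `GL_n(𝔸_K)`; the values of `Φ_0` do not depend
on it). Then for every Haar measure
`ν` of `N_n(𝔸_K)`, every fundamental domain `𝓕` of `N_n(K)`, every global character `ψ` and every `g`,
the family `δ ↦ W^ψ_{ν,𝓕}(diag(δ.out⁻¹, 1) g)`, `δ ∈ GL_{n-1}(K) ⧸ N_{n-1}(K)`, is absolutely summable with
sum `φ(g)`: `W^ψ_{ν,𝓕} = Φ_0(d_η ·)` (`exists_whittakerCoeff_eq_whittakerDepth_zero`), `d_η = diag(t_η, 1)`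
with `t_η` rational normalising `N_{n-1}(K)`, so the family is the Tate-normalised series at `d_η g`
re-indexed along `bijective_rightCoset_conj_out_inv`, whose sum is `φ(d_η g) = φ(g)`
(`hasSum_whittakerDepth_zero_of_summable`). [cite: CogdellAnalyticTheory2004, Thm. 1.1] -/
theorem hasSum_whittakerCoeff_of_summable
    [MeasurableSpace (GL (Fin n) (AdeleRing (𝓞 K) K))] [BorelSpace (GL (Fin n) (AdeleRing (𝓞 K) K))]
    [MeasurableSpace ↥(adelicUnipotent n K)] [BorelSpace ↥(adelicUnipotent n K)]
    (ν : Measure ↥(adelicUnipotent n K)) [IsHaarMeasure ν]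
    {𝓕 : Set ↥(adelicUnipotent n K)} (h𝓕 : IsFundamentalDomain ↥(rationalUnipotent n K) 𝓕 ν)
    {ψ : AddChar (AdeleRing (𝓞 K) K) Circle} (hψ : IsGlobalAddChar K ψ)
    {φ : GL (Fin n) (AdeleRing (𝓞 K) K) → ℂ}
    (hφ : IsCuspFormGL n K (isCompact_glFiniteIntegralLevel_holds n K) φ) (hn : 1 ≤ n)
    (hT : ∀ x : GL (Fin n) (AdeleRing (𝓞 K) K),
      Summable fun γ : Quotient (QuotientGroup.rightRel (upperUnitriangular (Fin (n - 1)) K)) =>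
        ‖whittakerDepth 0 φ (glCorner (AdeleRing (𝓞 K) K) (Nat.sub_le n 1) (ratGL K γ.out) * x)‖)
    (g : GL (Fin n) (AdeleRing (𝓞 K) K)) :
    Summable (fun δ : GL (Fin (n - 1)) K ⧸ upperUnitriangular (Fin (n - 1)) K =>
      ‖whittakerCoeff ν 𝓕 ψ φ
        (glCorner (AdeleRing (𝓞 K) K) (Nat.sub_le n 1)
          (Matrix.GeneralLinearGroup.map (algebraMap K (AdeleRing (𝓞 K) K)) δ.out⁻¹) * g)‖) ∧
    HasSum (fun δ : GL (Fin (n - 1)) K ⧸ upperUnitriangular (Fin (n - 1)) K =>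
      whittakerCoeff ν 𝓕 ψ φ
        (glCorner (AdeleRing (𝓞 K) K) (Nat.sub_le n 1)
          (Matrix.GeneralLinearGroup.map (algebraMap K (AdeleRing (𝓞 K) K)) δ.out⁻¹) * g)) (φ g) := by
  borelize (AdeleRing (𝓞 K) K)
  have hl : IsLeftInvariant (AdelicGroupData.gl n K) φ := hφ.1.leftInvariant
  have hφK : ∀ (δ : GL (Fin n) K) (x : GL (Fin n) (AdeleRing (𝓞 K) K)), φ (ratGL K δ * x) = φ x :=
    fun δ x => hl _ ⟨δ, rfl⟩ x
  have hφc : Continuous φ := hφ.1.continuous_gl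
  have hn0 : 0 < n := hn
  -- `W^ψ_{ν,𝓕} = Φ_0(d_η ·)`
  obtain ⟨η, hη⟩ := exists_whittakerCoeff_eq_whittakerDepth_zero ν h𝓕 hψ hl hφc hn
  set t : GL (Fin (n - 1)) K := glDiagonal (n - 1) K fun i : Fin (n - 1) => η ^ (n - 1 - (i : ℕ)) with htdef
  have ht : ∀ u : GL (Fin (n - 1)) K, u ∈ upperUnitriangular (Fin (n - 1)) K ↔
      t * u * t⁻¹ ∈ upperUnitriangular (Fin (n - 1)) K :=
    glDiagonal_conj_mem_upperUnitriangular_iff _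
  have hD : ratGL K (glDiagonal n K (fun i : Fin n => η ^ (n - 1 - (i : ℕ)))) =
      glCorner (AdeleRing (𝓞 K) K) (Nat.sub_le n 1) (ratGL K t) := ratGL_dilationDiagonal_eq_glCorner hn η
  -- the point `x' = d_η g` and the Tate-normalised family there
  set x' : GL (Fin n) (AdeleRing (𝓞 K) K) := glCorner (AdeleRing (𝓞 K) K) (Nat.sub_le n 1) (ratGL K t) * g
    with hx'
  set A : Quotient (QuotientGroup.rightRel (upperUnitriangular (Fin (n - 1)) K)) → ℂ := fun γ =>
    whittakerDepth 0 φ (glCorner (AdeleRing (𝓞 K) K) (Nat.sub_le n 1) (ratGL K γ.out) * x') with hA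
  have hAsum : Summable fun γ => ‖A γ‖ := hT x'
  have hAhas : HasSum A (φ g) := by
    have h := hasSum_whittakerDepth_zero_of_summable hφc hφK hφ.2 hn x' hAsum
    have e : φ x' = φ g := by rw [hx', ← hD]; exact hφK _ g
    rwa [e] at h
  -- the fact's family is `A` re-indexed
  set ρ : (GL (Fin (n - 1)) K ⧸ upperUnitriangular (Fin (n - 1)) K) →
      Quotient (QuotientGroup.rightRel (upperUnitriangular (Fin (n - 1)) K)) :=
    fun δ => Quotient.mk _ (t * δ.out⁻¹ * t⁻¹) with hρ
  have hρb : Function.Bijective ρ := bijective_rightCoset_conj_out_inv _ ht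
  set e := Equiv.ofBijective ρ hρb with hedef
  have hinvF : ∀ u ∈ upperUnitriangular (Fin (n - 1)) K, ∀ a : GL (Fin (n - 1)) K,
      whittakerDepth 0 φ (glCorner (AdeleRing (𝓞 K) K) (Nat.sub_le n 1) (ratGL K (u * a)) * x') =
        whittakerDepth 0 φ (glCorner (AdeleRing (𝓞 K) K) (Nat.sub_le n 1) (ratGL K a) * x') := by
    intro u hu a
    rw [show ratGL K (u * a) = ratGL K u * ratGL K a from map_mul _ u a, map_mul, mul_assoc]
    exact whittakerDepth_zero_glCorner_ratGL_mul hφK hn0 _ hu _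
  have hkey : ∀ δ : GL (Fin (n - 1)) K ⧸ upperUnitriangular (Fin (n - 1)) K,
      whittakerCoeff ν 𝓕 ψ φ (glCorner (AdeleRing (𝓞 K) K) (Nat.sub_le n 1)
        (Matrix.GeneralLinearGroup.map (algebraMap K (AdeleRing (𝓞 K) K)) δ.out⁻¹) * g) = A (e δ) := by
    intro δ
    simp only [hA, hedef, Equiv.ofBijective_apply, hρ]
    rw [apply_out_mk_eq_of_forall_mul_mem (upperUnitriangular (Fin (n - 1)) K)
      (f := fun a => whittakerDepth 0 φ (glCorner (AdeleRing (𝓞 K) K) (Nat.sub_le n 1) (ratGL K a) * x'))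
      hinvF, hη, hD, hx']
    change whittakerDepth 0 φ (glCorner (AdeleRing (𝓞 K) K) (Nat.sub_le n 1) (ratGL K t) *
        (glCorner (AdeleRing (𝓞 K) K) (Nat.sub_le n 1) (ratGL K δ.out⁻¹) * g)) =
      whittakerDepth 0 φ (glCorner (AdeleRing (𝓞 K) K) (Nat.sub_le n 1) (ratGL K (t * δ.out⁻¹ * t⁻¹)) *
        (glCorner (AdeleRing (𝓞 K) K) (Nat.sub_le n 1) (ratGL K t) * g))
    rw [show ratGL K (t * δ.out⁻¹ * t⁻¹) = ratGL K t * ratGL K δ.out⁻¹ * (ratGL K t)⁻¹ by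
      rw [show ratGL K (t * δ.out⁻¹ * t⁻¹) = ratGL K (t * δ.out⁻¹) * ratGL K t⁻¹ from map_mul _ _ _,
        show ratGL K (t * δ.out⁻¹) = ratGL K t * ratGL K δ.out⁻¹ from map_mul _ _ _,
        show ratGL K t⁻¹ = (ratGL K t)⁻¹ from map_inv _ _]]
    rw [map_mul, map_mul, map_inv]
    congr 1
    group
  refine ⟨?_, ?_⟩
  · have h1 : Summable ((fun γ => ‖A γ‖) ∘ e) := (e.summable_iff (f := fun γ => ‖A γ‖)).2 hAsum
    refine h1.congr fun δ => ?_
    rw [Function.comp_apply, hkey]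
  · have h1 : HasSum (A ∘ e) (φ g) := (e.hasSum_iff (f := A)).2 hAhas
    refine h1.congr_fun fun δ => ?_
    rw [Function.comp_apply, hkey]

open scoped Classical in
/-- **`Shalika1974_fourierExpansion_cuspForm` from the absolute convergence of the Whittaker series**
(Cogdell (2004), Thm. 1.1): for the given `n` and `K`, if the Tate-normalised Whittaker series
`γ ↦ Φ_0(diag(γ_𝔸, 1) x)`, `γ ∈ N_{n-1}(K) \ GL_{n-1}(K)`, of every cusp form `φ` on `GL_n(𝔸_K)` is
absolutely summable at every point `x`, then the Fourier–Whittaker expansion holds for every Haar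
measure of `N_n(𝔸_K)`, every fundamental domain of `N_n(K)`, every global character, every cusp form
and every point, with absolute convergence (`hasSum_whittakerCoeff_of_summable`; `n = 0` is
`Shalika1974_fourierExpansion_cuspForm_of_le_one`). The hypothesis is the analytic half of the printed
theorem ("convergence absolute and uniform on compact subsets") and is proved in the tree for `n ≤ 2`.
[cite: CogdellAnalyticTheory2004, Thm. 1.1] -/
theorem Shalika1974_fourierExpansion_cuspForm_of_summable
    (hT : ∀ [MeasurableSpace (GL (Fin n) (AdeleRing (𝓞 K) K))] [BorelSpace (GL (Fin n) (AdeleRing (𝓞 K) K))]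
      ⦃φ : GL (Fin n) (AdeleRing (𝓞 K) K) → ℂ⦄,
      IsCuspFormGL n K (isCompact_glFiniteIntegralLevel_holds n K) φ →
      ∀ x : GL (Fin n) (AdeleRing (𝓞 K) K),
        Summable fun γ : Quotient (QuotientGroup.rightRel (upperUnitriangular (Fin (n - 1)) K)) =>
          ‖whittakerDepth 0 φ (glCorner (AdeleRing (𝓞 K) K) (Nat.sub_le n 1) (ratGL K γ.out) * x)‖) :
    Shalika1974_fourierExpansion_cuspForm (n := n) (K := K) := by
  rcases Nat.lt_or_ge n 1 with hn | hn
  · exact Shalika1974_fourierExpansion_cuspForm_of_le_one (by omega)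
  · intro _ _ ν _ 𝓕 _ h𝓕 ψ hψ φ hφ g
    borelize (GL (Fin n) (AdeleRing (𝓞 K) K))
    exact hasSum_whittakerCoeff_of_summable ν h𝓕 hψ hφ hn (fun x => hT hφ x) g

/-! ### The converse: the named fact contains the absolute convergence -/

open scoped Classical in
/-- **The convergence half of the named fact, in Tate's normalisation**: conversely, if
`Shalika1974_fourierExpansion_cuspForm` holds (for `n`, `K`), then the Tate-normalised Whittaker series
`γ ↦ Φ_0(diag(γ_𝔸, 1) x)` of every cusp form is absolutely summable at every point (take a Haar measure
on `N_n(𝔸_K)`, Tate's box and Tate's character in the fact, `Φ_0 = W` by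
`whittakerDepth_zero_eq_whittakerCoeff`, and re-index the left cosets `δ.out⁻¹` by right cosets,
`bijective_rightCoset_conj_out_inv` with `t = 1`). So the hypothesis of
`Shalika1974_fourierExpansion_cuspForm_of_summable` is exactly the convergence clause of the fact.
[cite: CogdellAnalyticTheory2004, Thm. 1.1] -/
theorem summable_whittakerDepth_zero_of_fourierExpansion
    [MeasurableSpace (GL (Fin n) (AdeleRing (𝓞 K) K))] [BorelSpace (GL (Fin n) (AdeleRing (𝓞 K) K))]
    (hFE : Shalika1974_fourierExpansion_cuspForm (n := n) (K := K))
    {φ : GL (Fin n) (AdeleRing (𝓞 K) K) → ℂ}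
    (hφ : IsCuspFormGL n K (isCompact_glFiniteIntegralLevel_holds n K) φ)
    (x : GL (Fin n) (AdeleRing (𝓞 K) K)) :
    Summable fun γ : Quotient (QuotientGroup.rightRel (upperUnitriangular (Fin (n - 1)) K)) =>
      ‖whittakerDepth 0 φ (glCorner (AdeleRing (𝓞 K) K) (Nat.sub_le n 1) (ratGL K γ.out) * x)‖ := by
  rcases Nat.lt_or_ge n 1 with hn | hn
  · -- `n = 0`: one term
    haveI : Subsingleton (GL (Fin (n - 1)) K) := subsingleton_gl_fin_of_eq_zero (by omega)
    set γ₀ : Quotient (QuotientGroup.rightRel (upperUnitriangular (Fin (n - 1)) K)) := Quotient.mk _ 1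
      with hγ₀
    have hsub : ∀ γ : Quotient (QuotientGroup.rightRel (upperUnitriangular (Fin (n - 1)) K)), γ = γ₀ :=
      fun γ => by
        induction γ using Quotient.inductionOn with
        | h g => rw [hγ₀, Subsingleton.elim g 1]
    exact (hasSum_single (f := fun γ : Quotient (QuotientGroup.rightRel (upperUnitriangular (Fin (n - 1)) K)) =>
      ‖whittakerDepth 0 φ (glCorner (AdeleRing (𝓞 K) K) (Nat.sub_le n 1) (ratGL K γ.out) * x)‖) γ₀
      (fun γ hγ => absurd (hsub γ) hγ)).summable
  · -- `n ≥ 1`: the fact for a Haar measure, Tate's box and Tate's character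
    have hφc : Continuous φ := hφ.1.continuous_gl
    have hl : IsLeftInvariant (AdelicGroupData.gl n K) φ := hφ.1.leftInvariant
    have hφK : ∀ (δ : GL (Fin n) K) (y : GL (Fin n) (AdeleRing (𝓞 K) K)), φ (ratGL K δ * y) = φ y :=
      fun δ y => hl _ ⟨δ, rfl⟩ y
    set ν : Measure ↥(adelicUnipotent n K) := Measure.haar with hν
    have hB := (hFE ν measurableSet_unipotentTateDomain (isFundamentalDomain_unipotentTateDomain ν)
      (isGlobalAddChar_adeleAddChar K) hφ x).1
    -- `W = Φ_0`
    have hB' : Summable fun δ : GL (Fin (n - 1)) K ⧸ upperUnitriangular (Fin (n - 1)) K =>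
        ‖whittakerDepth 0 φ (glCorner (AdeleRing (𝓞 K) K) (Nat.sub_le n 1) (ratGL K δ.out⁻¹) * x)‖ := by
      refine hB.congr fun δ => ?_
      rw [← whittakerDepth_zero_eq_whittakerCoeff hφc hn ν]
    -- re-index by right cosets (`t = 1`)
    have ht : ∀ u : GL (Fin (n - 1)) K, u ∈ upperUnitriangular (Fin (n - 1)) K ↔
        1 * u * 1⁻¹ ∈ upperUnitriangular (Fin (n - 1)) K := fun u => by rw [one_mul, inv_one, mul_one]
    set e := Equiv.ofBijective _ (bijective_rightCoset_conj_out_inv (upperUnitriangular (Fin (n - 1)) K) ht)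
      with hedef
    have hinvF : ∀ u ∈ upperUnitriangular (Fin (n - 1)) K, ∀ a : GL (Fin (n - 1)) K,
        whittakerDepth 0 φ (glCorner (AdeleRing (𝓞 K) K) (Nat.sub_le n 1) (ratGL K (u * a)) * x) =
          whittakerDepth 0 φ (glCorner (AdeleRing (𝓞 K) K) (Nat.sub_le n 1) (ratGL K a) * x) := by
      intro u hu a
      rw [show ratGL K (u * a) = ratGL K u * ratGL K a from map_mul _ u a, map_mul, mul_assoc]
      exact whittakerDepth_zero_glCorner_ratGL_mul hφK hn _ hu _
    have hkey : ∀ δ : GL (Fin (n - 1)) K ⧸ upperUnitriangular (Fin (n - 1)) K,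
        ‖whittakerDepth 0 φ (glCorner (AdeleRing (𝓞 K) K) (Nat.sub_le n 1) (ratGL K (e δ).out) * x)‖ =
          ‖whittakerDepth 0 φ (glCorner (AdeleRing (𝓞 K) K) (Nat.sub_le n 1) (ratGL K δ.out⁻¹) * x)‖ := by
      intro δ
      simp only [hedef, Equiv.ofBijective_apply]
      rw [apply_out_mk_eq_of_forall_mul_mem (upperUnitriangular (Fin (n - 1)) K)
        (f := fun a => whittakerDepth 0 φ (glCorner (AdeleRing (𝓞 K) K) (Nat.sub_le n 1) (ratGL K a) * x))
        hinvF, one_mul, inv_one, mul_one]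
    refine (e.summable_iff (f := fun γ : Quotient (QuotientGroup.rightRel (upperUnitriangular (Fin (n - 1)) K)) =>
      ‖whittakerDepth 0 φ (glCorner (AdeleRing (𝓞 K) K) (Nat.sub_le n 1) (ratGL K γ.out) * x)‖)).1 ?_
    refine hB'.congr fun δ => ?_
    rw [Function.comp_apply, hkey]

open scoped Classical in
/-- **`Shalika1974_fourierExpansion_cuspForm` is equivalent to the absolute convergence of the
Tate-normalised Whittaker series of cusp forms** (for the given `n`, `K`): the expansion identity is
a theorem (`Shalika1974_fourierExpansion_cuspForm_of_summable`), the convergence is the content.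
[cite: CogdellAnalyticTheory2004, Thm. 1.1] -/
theorem Shalika1974_fourierExpansion_cuspForm_iff_summable :
    Shalika1974_fourierExpansion_cuspForm (n := n) (K := K) ↔
      ∀ [MeasurableSpace (GL (Fin n) (AdeleRing (𝓞 K) K))] [BorelSpace (GL (Fin n) (AdeleRing (𝓞 K) K))]
        ⦃φ : GL (Fin n) (AdeleRing (𝓞 K) K) → ℂ⦄,
        IsCuspFormGL n K (isCompact_glFiniteIntegralLevel_holds n K) φ →
        ∀ x : GL (Fin n) (AdeleRing (𝓞 K) K),
          Summable fun γ : Quotient (QuotientGroup.rightRel (upperUnitriangular (Fin (n - 1)) K)) =>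
            ‖whittakerDepth 0 φ (glCorner (AdeleRing (𝓞 K) K) (Nat.sub_le n 1) (ratGL K γ.out) * x)‖ :=
  ⟨fun hFE _ _ _ hφ x => summable_whittakerDepth_zero_of_fourierExpansion hFE hφ x,
    fun hT => Shalika1974_fourierExpansion_cuspForm_of_summable
      (@fun I₁ I₂ φ hφ x => @hT I₁ I₂ φ hφ x)⟩

end Expansion

end Literature.NumberTheory.Automorphic
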